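import Mathlib
import Summits.ValiantsHypothesis.ValiantsHypothesis.Theorems.FifoMatchingNNDivisionHardGrandResidual
import Summits.ValiantsHypothesis.ValiantsHypothesis.Theorems.FifoMatchingNNDivisionHardFewArcFaces
import HarnessLib

/-!
# Route FifoMatching — crux `NNDivisionHard` (stmt-ValiantsHypothesis-21181): the GRAND RESIDUAL ∧ BOUNDED-ARC-SET
# NON-GENERIC — one residual of record, by name

`…GrandResidual.nnDivisionHard_iff_grandResidual` (✓ p823791): 21181 ⟺ the inequality for cofactors that are cheap ∧
torus-homogeneous ∧ window-dense ∧ deep ∧ spread ∧ undominated.  `…FewArcFaces.fewArcsGeneric_not_certificate_qp`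
(✓ p832389): a cofactor generic for SOME arc set of size `≤ k` is not a certificate.  Since the grand residual's `⟸` already
normalises an arbitrary certificate INTO the residual class, the new conjunct intersects for free (the genericity test is
applied to the residual member itself, no inheritance under sub-supports is needed):

* ★ BY NAME `nnDivisionHard_iff_grandResidualArcs` — **`Theses.FifoMatching.NNDivisionHard` ⟺ for all `k c`, eventually in
  `n`, every `h ≠ 0` that is cheap, torus-homogeneous, window-dense, deep, spread, undominated AND non-generic for every arc set
  of size `≤ k` (every outer face `top_{𝟙_{I^c}} h`, `|I| ≤ k`, has ≥ 2 terms) satisfies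
  `2^((log₂ n + c)^c) < L₊(NN_n · h) + L₊(h)`.**

HONEST FRAMING: residual book-keeping BY NAME; `NNDivisionHard`, `NNNotVP`, VP ≠ VNP stay OPEN (NOT proved).  No definitions,
no named facts.  References: Hrubeš–Yehudayoff 2021 §6 Problem 2 [HrubesYehudayoff2021].
-/

noncomputable section

-- Sub = Summit single-conjunct layout: the duplicated namespace component is mandated by the tree.
set_option linter.dupNamespace false
set_option autoImplicit false

namespace Summit.ValiantsHypothesis.ValiantsHypothesis.Theorems.FifoMatching.NNDivisionHard.GrandResidualArcs

open MvPolynomial Finset Literature.Computability.AlgebraicComplexity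
open scoped NNReal BigOperators Classical
open Summit.ValiantsHypothesis.ValiantsHypothesis.Theorems.ZeroOneTransfer.Negative (topComponent)
open Summit.ValiantsHypothesis.ValiantsHypothesis.Theorems.FifoMatching.NNLowDegreeCofactorHard (vertexDeg)
open Summit.ValiantsHypothesis.ValiantsHypothesis.Theorems.FifoMatching.NNNotVP.DivisionSplit (σ NN SuppFn freeVars)
open Summit.ValiantsHypothesis.ValiantsHypothesis.Theorems.FifoMatching.NNDivisionHard.GrandResidual
  (nnDivisionHard_iff_grandResidual)
open Summit.ValiantsHypothesis.ValiantsHypothesis.Theorems.FifoMatching.NNDivisionHard.FewArcFaces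
  (fewArcsGeneric_not_certificate_qp)

/-- ★ **BY NAME: `NNDivisionHard` ⟺ grand residual ∧ bounded-arc-set non-generic.** [cite: HrubesYehudayoff2021, §6 Problem 2] -/
theorem nnDivisionHard_iff_grandResidualArcs :
    Summit.ValiantsHypothesis.ValiantsHypothesis.Theses.FifoMatching.NNDivisionHard ↔
      ∀ k c : ℕ, ∃ n₀ : ℕ, ∀ n ≥ n₀, ∀ h : MvPolynomial (Fin (2 * n) × Fin (2 * n)) ℝ≥0, h ≠ 0 →
        complexity h ≤ 2 ^ ((Nat.log 2 n + c) ^ c) →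
        (∀ d ∈ h.support, ∀ d' ∈ h.support, vertexDeg d = vertexDeg d') →
        (∀ d ∈ h.support, ∀ s : ℕ,
          s + (2 * ((Nat.log 2 n + c) ^ c + Nat.log 2 n + 1) ^ 6 + 12) ≤ 2 * n →
          ∃ e ∈ d.support,
            (s ≤ e.1.val ∧ e.1.val < s + (2 * ((Nat.log 2 n + c) ^ c + Nat.log 2 n + 1) ^ 6 + 12)) ∨
            (s ≤ e.2.val ∧ e.2.val < s + (2 * ((Nat.log 2 n + c) ^ c + Nat.log 2 n + 1) ^ 6 + 12))) →
        (∀ e : ℕ, e ≤ 2 ^ ((Nat.log 2 n + k) ^ k) → homogeneousComponent e h = 0) →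
        (∀ d ∈ h.support, (Nat.log 2 n + k) ^ k < d.support.card) →
        (∀ T : Finset (σ n), T.card ≤ (Nat.log 2 n + k) ^ k →
          ∃ A : Finset (σ n), SuppFn (freeVars T (NN n)) A ∧ ¬ SuppFn (freeVars T h) A) →
        (∀ I : Finset (Fin (2 * n) × Fin (2 * n)), I.card ≤ k →
          ∀ (d : (Fin (2 * n) × Fin (2 * n)) →₀ ℕ) (a : ℝ≥0), a ≠ 0 →
            topComponent (fun v : Fin (2 * n) × Fin (2 * n) => if v ∈ I then 0 else 1) h ≠ monomial d a) →
        2 ^ ((Nat.log 2 n + c) ^ c) <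
          complexity (nestFreeMatchingPoly n ℝ≥0 * h) + complexity h := by
  constructor
  · intro H k c
    obtain ⟨n₀, hn₀⟩ := H c
    exact ⟨n₀, fun n hn h hh _ _ _ _ _ _ _ => hn₀ n hn h hh⟩
  · intro H
    refine nnDivisionHard_iff_grandResidual.mpr fun k c => ?_
    obtain ⟨n₀, hn₀⟩ := H k c
    obtain ⟨n₁, hn₁⟩ := fewArcsGeneric_not_certificate_qp k c
    refine ⟨max n₀ n₁, fun n hn h hh hcheap htor hdense hdeep hspread hund => ?_⟩
    by_cases hgen : ∃ I : Finset (Fin (2 * n) × Fin (2 * n)), I.card ≤ k ∧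
        ∃ (d : (Fin (2 * n) × Fin (2 * n)) →₀ ℕ) (a : ℝ≥0), a ≠ 0 ∧
          topComponent (fun v : Fin (2 * n) × Fin (2 * n) => if v ∈ I then 0 else 1) h = monomial d a
    · obtain ⟨I, hI, d, a, ha, htop⟩ := hgen
      exact hn₁ n (le_trans (le_max_right _ _) hn) I hI h d a ha htop
    · push Not at hgen
      exact hn₀ n (le_trans (le_max_left _ _) hn) h hh hcheap htor hdense hdeep hspread hund
        fun I hI d a ha => hgen I hI d a ha

end Summit.ValiantsHypothesis.ValiantsHypothesis.Theorems.FifoMatching.NNDivisionHard.GrandResidualArcs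

end
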